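import Literature.Barriers.CriticalPhenomena.WeaklySAWFluctuationIntegral
import Literature.Barriers.CriticalPhenomena.WeaklySAWFieldSubstitution
import HarnessLib

/-!
# BBS 2015, §4.1, eqs. (4.24)–(4.25): the degree-zero part of `E_C θ F` is the translated expectation,
# `(E_C θ F)⁰(φ) = ∫ e^{-S_A(ξ,η)} F(φ+ξ, η)`

Sequel to `WeaklySAWFluctuationIntegral.lean` (`E_C θ : 𝒩 → 𝒩`, `convTheta`) and
`WeaklySAWFieldSubstitution.lean` (`substForm`). Bauerschmidt–Brydges–Slade, CMP 337 (2015),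
arXiv:1403.7422, §4.1: "We denote the degree-`0` part of `Z_N = E_Cθ Z₀` by `Z_N⁰`, i.e., `Z_N⁰` is a
function `Z_N⁰ : ℂ^Λ → ℂ`" ((4.24)), used in (4.25) `Σ(J,J̄) = e^{(J,CJ̄)} Z_N⁰(CJ, CJ̄)`. This file proves
that the degree-zero part of `E_C θ F`, evaluated at the external field `φ`, is the super-integral in the
fluctuation variables of the translated form:

* `degZero F` (the coefficient of `1`, "`F⁰`"), `projEta` (the `ψ`-degree-zero projection of `𝒩^×`),
  `projEta_psiGen_mul`, `projEta_etaGen_mul`, `projEta_mapEta_mul`, and the structural identity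
  **`projEta_shiftPsi_mapPsi`**: the `ψ`-free part of `(ψ+η)^t` is `η^t`, i.e.
  `projEta (Δ(ψ-block x)) = η-block x`;
* `repr_empty_berezinOn_etaSet` (only the `ψ`-free part contributes to the constant coefficient of
  `∫dη̄dη`), `berezin_coeffMap_fluct_mul_coeffMap_shift` (evaluation of coefficients at `(φ,ξ)`);
* **`degZero_convTheta`**: for every matrix `A`, every form `F` and every `φ`,
  `(E_C θ F)⁰(φ) = ∫ e^{-S_A(ξ,η)} F(φ+ξ, η) = superIntegral (superGauss A * substForm (φ + ·) F)` —
  so that the function `Z_N⁰` of (4.24) is `h ↦ ∫ e^{-S_A} Z₀(h+ξ, η)` (the definition `ZN0` used for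
  (4.25) in `WeaklySAWGeneratingFunctional.lean`, with `A = C⁻¹ = -Δ+m²`).

Everything is proved; no named facts.
-/

noncomputable section

open MeasureTheory Complex ComplexConjugate
open Literature.MathematicalPhysics.QuantumLattice
open Literature.MathematicalPhysics.QuantumLattice.GrassmannAlgebra (berezin gen coeffMap grassmannBasis berezinOn)
open scoped BigOperators

namespace Literature.Barriers.CriticalPhenomena

namespace CTWSAW

section DegreeZero

variable {Λ : Type*} [LinearOrder Λ] [Fintype Λ]

/-- **The degree-zero part `F⁰` of a form** (its coefficient of `1`, a function of `φ`).
[cite: BauerschmidtBrydgesSlade2015LogCorr, §4.1, eq. (4.24) ("the degree-0 part of Z_N")] -/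
def degZero (F : SForm Λ) : FieldFun Λ := (grassmannBasis (FieldFun Λ) (Λ ⊕ₗ Λ)).repr F ∅

/-- `(f·1)⁰ = f`. [folklore] -/
theorem degZero_ofFun (f : FieldFun Λ) : degZero (ofFun f) = f := by
  classical
  rw [degZero, ofFun, Algebra.algebraMap_eq_smul_one, map_smul, Finsupp.smul_apply, smul_eq_mul,
    ← GrassmannAlgebra.grassmannBasis_empty, Module.Basis.repr_self, Finsupp.single_eq_same, mul_one]

/-! #### The `ψ`-degree-zero projection of `𝒩^×` -/

/-- The projection of `𝒩^×` onto the forms without `ψ̄, ψ` generators (monomials inside the `η`-block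
are kept, all others are sent to `0`). [folklore] -/
def projEta : SForm2 Λ →ₗ[FieldFun2 Λ] SForm2 Λ :=
  (grassmannBasis (FieldFun2 Λ) (DGen Λ)).constr (FieldFun2 Λ) fun t =>
    if t ⊆ etaSet Λ then grassmannBasis (FieldFun2 Λ) (DGen Λ) t else 0

/-- `projEta` on monomials. [folklore] -/
theorem projEta_basis (t : Finset (DGen Λ)) :
    projEta (grassmannBasis (FieldFun2 Λ) (DGen Λ) t) =
      if t ⊆ etaSet Λ then grassmannBasis (FieldFun2 Λ) (DGen Λ) t else 0 := by
  rw [projEta, Module.Basis.constr_basis]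

/-- The `ψ`-block is disjoint from `etaSet`. [folklore] -/
theorem blockPsi_not_mem_etaSet (k : Λ ⊕ₗ Λ) : blockPsi Λ k ∉ etaSet Λ := by
  simp only [etaSet, Finset.mem_map, Finset.mem_univ, true_and, not_exists]
  intro k' h
  have h' : toLex (Sum.inr k') = toLex (Sum.inl k) := h
  exact Sum.inl_ne_inr (toLex.injective h').symm

/-- The `η`-block is `etaSet`. [folklore] -/
theorem blockEta_mem_etaSet (k : Λ ⊕ₗ Λ) : blockEta Λ k ∈ etaSet Λ :=
  Finset.mem_map.2 ⟨k, Finset.mem_univ _, rfl⟩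

/-- `projEta 1 = 1`. [folklore] -/
theorem projEta_one : projEta (1 : SForm2 Λ) = 1 := by
  rw [← GrassmannAlgebra.grassmannBasis_empty, projEta_basis, if_pos (Finset.empty_subset _)]

/-- **A `ψ`-generator kills the `ψ`-free part**: `projEta (ψ'_k · y) = 0`. [folklore] -/
theorem projEta_psiGen_mul (k : Λ ⊕ₗ Λ) (y : SForm2 Λ) :
    projEta (gen (FieldFun2 Λ) (blockPsi Λ k) * y) = 0 := by
  classical
  conv_lhs => rw [← (grassmannBasis (FieldFun2 Λ) (DGen Λ)).sum_repr y]
  rw [Finset.mul_sum, map_sum]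
  refine Finset.sum_eq_zero fun t _ => ?_
  rw [mul_smul_comm, map_smul]
  by_cases hk : blockPsi Λ k ∈ t
  · rw [GrassmannAlgebra.gen_mul_grassmannBasis_of_mem _ hk, map_zero, smul_zero]
  · rw [GrassmannAlgebra.gen_mul_grassmannBasis_of_not_mem _ hk, map_smul, projEta_basis, if_neg, smul_zero, smul_zero]
    exact fun h => blockPsi_not_mem_etaSet k (h (Finset.mem_insert_self _ _))

/-- **An `η`-generator commutes with the projection**: `projEta (η'_k · y) = η'_k · projEta y`. [folklore] -/
theorem projEta_etaGen_mul (j : DGen Λ) (hj : j ∈ etaSet Λ) (y : SForm2 Λ) :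
    projEta (gen (FieldFun2 Λ) j * y) = gen (FieldFun2 Λ) j * projEta y := by
  classical
  conv_lhs => rw [← (grassmannBasis (FieldFun2 Λ) (DGen Λ)).sum_repr y]
  conv_rhs => rw [← (grassmannBasis (FieldFun2 Λ) (DGen Λ)).sum_repr y]
  rw [Finset.mul_sum, map_sum, map_sum, Finset.mul_sum]
  refine Finset.sum_congr rfl fun t _ => ?_
  rw [mul_smul_comm, map_smul, map_smul, mul_smul_comm, projEta_basis]
  by_cases hk : j ∈ t
  · rw [GrassmannAlgebra.gen_mul_grassmannBasis_of_mem _ hk, map_zero]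
    split_ifs
    · rw [GrassmannAlgebra.gen_mul_grassmannBasis_of_mem _ hk]
    · rw [mul_zero]
  · rw [GrassmannAlgebra.gen_mul_grassmannBasis_of_not_mem _ hk, map_smul, projEta_basis]
    by_cases ht : t ⊆ etaSet Λ
    · rw [if_pos (Finset.insert_subset hj ht), if_pos ht, GrassmannAlgebra.gen_mul_grassmannBasis_of_not_mem _ hk]
    · rw [if_neg (fun h => ht ((Finset.subset_insert _ _).trans h)), if_neg ht, smul_zero, mul_zero]

/-- Monomials of the `η`-block commute with the projection. [folklore] -/
theorem projEta_basis_mul {t : Finset (DGen Λ)} (ht : t ⊆ etaSet Λ) (y : SForm2 Λ) :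
    projEta (grassmannBasis (FieldFun2 Λ) (DGen Λ) t * y) = grassmannBasis (FieldFun2 Λ) (DGen Λ) t * projEta y := by
  induction t using Finset.induction_on_min generalizing y with
  | empty => rw [GrassmannAlgebra.grassmannBasis_empty, one_mul, one_mul]
  | insert a u hmin ih =>
    have ha : a ∈ etaSet Λ := ht (Finset.mem_insert_self a u)
    have hu : u ⊆ etaSet Λ := (Finset.subset_insert a u).trans ht
    rw [GrassmannAlgebra.grassmannBasis_insert_of_forall_lt _ hmin, mul_assoc, projEta_etaGen_mul a ha, ih hu, mul_assoc]

/-- **Forms of the fluctuation fields commute with the projection**: `projEta (η-block x · y) = η-block x · projEta y`.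
[folklore] -/
theorem projEta_mapEta_mul (x : GrassmannAlgebra (FieldFun2 Λ) (Λ ⊕ₗ Λ)) (y : SForm2 Λ) :
    projEta (mapEta x * y) = mapEta x * projEta y := by
  conv_lhs => rw [← (grassmannBasis (FieldFun2 Λ) (Λ ⊕ₗ Λ)).sum_repr x]
  conv_rhs => rw [← (grassmannBasis (FieldFun2 Λ) (Λ ⊕ₗ Λ)).sum_repr x]
  rw [map_sum, Finset.sum_mul, map_sum, Finset.sum_mul]
  refine Finset.sum_congr rfl fun u _ => ?_
  rw [map_smul, smul_mul_assoc, map_smul, smul_mul_assoc, mapEta, GrassmannAlgebra.map_extendByZero_grassmannBasis]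
  congr 1
  refine projEta_basis_mul (fun j hj => ?_) y
  obtain ⟨k, -, rfl⟩ := Finset.mem_map.1 hj
  exact blockEta_mem_etaSet k

/-- `0`-forms commute with the projection. [folklore] -/
theorem projEta_ofFun2_mul (h : FieldFun2 Λ) (y : SForm2 Λ) : projEta (ofFun2 h * y) = ofFun2 h * projEta y := by
  rw [ofFun2, ← Algebra.smul_def, map_smul, Algebra.smul_def]

/-- **The `ψ`-free part of `Δ(ψ-block x)` is `η-block x`**: in `θF = F(φ+ξ, ψ+η)` the terms without `ψ`
are those of `F(φ+ξ, η)`. [cite: BauerschmidtBrydgesSlade2015LogCorr, §4.1, eqs. (4.21), (4.24) (the degree-0 part of E_Cθ Z₀)] -/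
theorem projEta_shiftPsi_mapPsi (x : GrassmannAlgebra (FieldFun2 Λ) (Λ ⊕ₗ Λ)) :
    projEta (shiftPsi (mapPsi x)) = mapEta x := by
  have hmapPsi : ∀ a : Λ ⊕ₗ Λ, mapPsi (gen (FieldFun2 Λ) a) = gen (FieldFun2 Λ) (blockPsi Λ a) := fun a => by
    unfold mapPsi; exact GrassmannAlgebra.map_extendByZero_gen' _ _ _
  have hgen : ∀ a : Λ ⊕ₗ Λ, shiftPsi (mapPsi (gen (FieldFun2 Λ) a)) =
      gen (FieldFun2 Λ) (blockPsi Λ a) + gen (FieldFun2 Λ) (blockEta Λ a) := fun a => by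
    rw [hmapPsi]; unfold shiftPsi; exact map_one_add_fieldShift_gen_range _ _ _ _
  have hgen' : ∀ a : Λ ⊕ₗ Λ, mapEta (gen (FieldFun2 Λ) a) = gen (FieldFun2 Λ) (blockEta Λ a) := fun a => by
    unfold mapEta; exact GrassmannAlgebra.map_extendByZero_gen' _ _ _
  -- on ordered products of generators (no distinctness needed)
  have hlist : ∀ l : List (Λ ⊕ₗ Λ), projEta (shiftPsi (mapPsi (l.map (gen (FieldFun2 Λ))).prod)) =
      mapEta (l.map (gen (FieldFun2 Λ))).prod := by
    intro l
    induction l with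
    | nil => rw [List.map_nil, List.prod_nil, map_one, map_one, projEta_one, map_one]
    | cons a l ih =>
      rw [List.map_cons, List.prod_cons, map_mul (mapPsi (Λ := Λ)), map_mul (shiftPsi (Λ := Λ)),
        map_mul (mapEta (Λ := Λ)), hgen, hgen', add_mul, map_add, projEta_psiGen_mul, zero_add,
        projEta_etaGen_mul _ (blockEta_mem_etaSet a), ih]
  have hbasis : ∀ s : Finset (Λ ⊕ₗ Λ), projEta (shiftPsi (mapPsi (grassmannBasis (FieldFun2 Λ) (Λ ⊕ₗ Λ) s))) =
      mapEta (grassmannBasis (FieldFun2 Λ) (Λ ⊕ₗ Λ) s) := by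
    intro s
    rw [GrassmannAlgebra.grassmannBasis_eq_prod_map_gen]
    exact hlist _
  conv_lhs => rw [← (grassmannBasis (FieldFun2 Λ) (Λ ⊕ₗ Λ)).sum_repr x]
  conv_rhs => rw [← (grassmannBasis (FieldFun2 Λ) (Λ ⊕ₗ Λ)).sum_repr x]
  simp only [map_sum, map_smul, hbasis]

/-! #### The constant coefficient of the `η`-integral -/

/-- **Only the `ψ`-free part contributes to the constant coefficient of `∫dη̄dη`.** [folklore] -/
theorem repr_empty_berezinOn_etaSet (Z : SForm2 Λ) :
    (grassmannBasis (FieldFun2 Λ) (DGen Λ)).repr (berezinOn (FieldFun2 Λ) (etaSet Λ) Z) ∅ =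
      (grassmannBasis (FieldFun2 Λ) (DGen Λ)).repr (berezinOn (FieldFun2 Λ) (etaSet Λ) (projEta Z)) ∅ := by
  classical
  -- both sides are linear in `Z`; compare on monomials
  set L : SForm2 Λ →ₗ[FieldFun2 Λ] FieldFun2 Λ :=
    (Finsupp.lapply ∅) ∘ₗ (grassmannBasis (FieldFun2 Λ) (DGen Λ)).repr.toLinearMap ∘ₗ berezinOn (FieldFun2 Λ) (etaSet Λ)
    with hL
  suffices h : L = L ∘ₗ projEta from LinearMap.congr_fun h Z
  refine (grassmannBasis (FieldFun2 Λ) (DGen Λ)).ext fun t => ?_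
  show L _ = L (projEta _)
  rw [projEta_basis]
  by_cases ht : t ⊆ etaSet Λ
  · rw [if_pos ht]
  · rw [if_neg ht, map_zero]
    simp only [hL, LinearMap.comp_apply, LinearEquiv.coe_coe, Finsupp.lapply_apply, GrassmannAlgebra.berezinOn_grassmannBasis]
    by_cases hst : etaSet Λ ⊆ t
    · rw [if_pos hst, map_smul, Finsupp.smul_apply, Module.Basis.repr_self, Finsupp.single_apply, if_neg, smul_zero]
      intro h0
      apply ht
      intro j hj
      by_contra hj'
      have : j ∈ t \ etaSet Λ := Finset.mem_sdiff.2 ⟨hj, hj'⟩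
      rw [h0] at this
      exact absurd this (Finset.notMem_empty j)
    · rw [if_neg hst, map_zero, Finsupp.zero_apply]

/-- Coefficientwise evaluation: the top `η`-coefficient of `e(ξ,η)·F(φ+ξ,η)` at `(φ,ξ)` is the top
coefficient of `e(ξ,ψ)·F(φ+ξ,ψ)` at `ξ`. [folklore] -/
theorem berezin_coeffMap_fluct_mul_coeffMap_shift (E F : SForm Λ) (φ ξ : Λ → ℂ) :
    berezin (FieldFun2 Λ) (Λ ⊕ₗ Λ) (coeffMap fluctCoeff E * coeffMap shiftCoeff F) (φ, ξ) =
      berezin (FieldFun Λ) (Λ ⊕ₗ Λ) (E * substForm (fun ξ' => φ + ξ') F) ξ := by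
  set ev₂ : FieldFun2 Λ →+* ℂ := Pi.evalRingHom (fun _ : (Λ → ℂ) × (Λ → ℂ) => ℂ) (φ, ξ) with hev₂
  set ev : FieldFun Λ →+* ℂ := Pi.evalRingHom (fun _ : Λ → ℂ => ℂ) ξ with hev
  have h1 : ev₂.comp fluctCoeff = ev := by ext f; rfl
  have h2 : ev₂.comp shiftCoeff = ev.comp (fieldPrecomp fun ξ' => φ + ξ') := by ext f; rfl
  have lhs : berezin (FieldFun2 Λ) (Λ ⊕ₗ Λ) (coeffMap fluctCoeff E * coeffMap shiftCoeff F) (φ, ξ) =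
      ev₂ (berezin (FieldFun2 Λ) (Λ ⊕ₗ Λ) (coeffMap fluctCoeff E * coeffMap shiftCoeff F)) := rfl
  have rhs : berezin (FieldFun Λ) (Λ ⊕ₗ Λ) (E * substForm (fun ξ' => φ + ξ') F) ξ =
      ev (berezin (FieldFun Λ) (Λ ⊕ₗ Λ) (E * substForm (fun ξ' => φ + ξ') F)) := rfl
  rw [lhs, rhs, ← GrassmannAlgebra.berezin_coeffMap, ← GrassmannAlgebra.berezin_coeffMap, map_mul (coeffMap ev₂),
    map_mul (coeffMap ev), GrassmannAlgebra.coeffMap_comp, GrassmannAlgebra.coeffMap_comp, substForm,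
    GrassmannAlgebra.coeffMap_comp, h1, h2]

/-! #### The degree-zero part of `E_C θ F` -/

/-- **`(E_C θ F)⁰(φ) = ∫ e^{-S_A(ξ,η)} F(φ+ξ, η)`**: the degree-zero part of `Z_N = E_Cθ Z₀` ((4.24)),
evaluated at the external field `φ`, is the super-integral in the fluctuation variables of the translated
form — the function `Z_N⁰ : ℂ^Λ → ℂ` entering (4.25) (every matrix `A`, `C = A⁻¹`; every form `F`).
[cite: BauerschmidtBrydgesSlade2015LogCorr, §4.1, eqs. (4.24)–(4.25)] -/
theorem degZero_convTheta (A : Matrix Λ Λ ℂ) (F : SForm Λ) (φ : Λ → ℂ) :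
    degZero (convTheta A F) φ = superIntegral (superGauss A * substForm (fun ξ => φ + ξ) F) := by
  classical
  -- the coefficient of `1` of the finite sum defining `fluctExpectation`
  rw [degZero, convTheta, fluctExpectation, Module.Basis.repr_sum_self]
  simp only [fluctCoeffOf, Finset.map_empty]
  -- only the `ψ`-free part matters, and it is `e^{-ξAξ̄} · η-block(e^{-ηAη̄} · F(φ+ξ))`
  have hproj : projEta (embedEta (superGauss A) * thetaForm F) =
      ofFun2 (fun p => Boson.gaussWeight A p.2) *
        mapEta (coeffMap fluctCoeff (grassmannExp (-fermionAction A)) * coeffMap shiftCoeff F) := by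
    rw [embedEta_superGauss, thetaForm_apply, mul_assoc, projEta_ofFun2_mul, projEta_mapEta_mul,
      projEta_shiftPsi_mapPsi, map_mul]
  have hber : berezinOn (FieldFun2 Λ) (etaSet Λ) (projEta (embedEta (superGauss A) * thetaForm F)) =
      ofFun2 ((fun p => Boson.gaussWeight A p.2) * berezin (FieldFun2 Λ) (Λ ⊕ₗ Λ)
        (coeffMap fluctCoeff (grassmannExp (-fermionAction A)) * coeffMap shiftCoeff F)) := by
    rw [hproj, berezinOn_ofFun2_mul, etaSet, mapEta, GrassmannAlgebra.berezinOn_map_map_extendByZero,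
      GrassmannAlgebra.berezinOn_univ_holds (FieldFun2 Λ) _, AlgHom.commutes, ofFun2, ofFun2, ← map_mul]
  rw [repr_empty_berezinOn_etaSet, hber, superIntegral]
  congr 1
  refine integral_congr_ae (Filter.Eventually.of_forall fun ξ => ?_)
  rw [repr_ofFun2, if_pos rfl]
  show Boson.gaussWeight A ξ * berezin (FieldFun2 Λ) (Λ ⊕ₗ Λ)
    (coeffMap fluctCoeff (grassmannExp (-fermionAction A)) * coeffMap shiftCoeff F) (φ, ξ) = _
  rw [berezin_coeffMap_fluct_mul_coeffMap_shift, superGauss, mul_assoc, berezin_ofFun_mul, Pi.mul_apply]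

end DegreeZero

end CTWSAW

end Literature.Barriers.CriticalPhenomena
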